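import Mathlib
import Literature.Analysis.Complex.FourierPolyaKiKimEngine
import HarnessLib

/-!
# Upper semicontinuity of the real zero count under `C^k`-convergence

Handoff track (ROUTE 1′), prove-1 gen13, for idea-3 gen22's ROUTE R-K «COUNT-AND-THIN»
(HOME/handoff/IDEAS-finite-rank.md §G22-3/§G22-4, TASK H-K1). Pure real analysis, RH-free,
Mathlib-only imports.

If `g : ℝ → ℝ` is continuous, its zeros in `[a, b]` lie in a finite set `Z`, at each `c ∈ Z` some
derivative `g^{(k c)}` is continuous and non-zero, and `G n → g` uniformly on `[a, b]` together with
`(G n)^{(k c)} → g^{(k c)}` for each `c ∈ Z`, each `G n` being `C^N` with `k c ≤ N`, then eventually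
the zero set of `G n` in `[a, b]` is finite with at most `∑_{c ∈ Z} k c` elements
(`eventually_ncard_zeros_le`). The only tool is Rolle's theorem between consecutive zeros
(`exists_iteratedDeriv_eq_zero_of_card`, the convex-hull form of the iterated Rolle lemma; compare
the private `rolle_chain` of `Literature/Analysis/Approximation/InterpolationRemainder.lean`, whose
conclusion is located only in the ambient open interval); the `ℂ → ℝ` bridges are the tree's
`Literature.Analysis.Complex.KiKim.iteratedDeriv_re_ofReal` / `im_iteratedDeriv_ofReal_eq_zero`. This is the real-variable substitute for
the counting half of Hurwitz's theorem (the tree has the existence half only,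
`Literature/Analysis/Complex/Hurwitz.lean`). Nothing here bears on the truth of RH.
-/

set_option linter.dupNamespace false

noncomputable section

open Filter Set Topology Metric
open scoped BigOperators

namespace Summit.RiemannHypothesis.RiemannHypothesis.Theorems

namespace RealZeroCount

/-! ## Rolle on finite zero sets, convex-hull form -/

/-- Rolle between consecutive zeros, hull form: if the continuous `g` vanishes on a nonempty finite
set `s ⊆ [u, v]`, then `deriv g` vanishes on a finite set `s' ⊆ [u, v]` with `#s' + 1 = #s`.
(Adapted from the private `rolle_finset` of `InterpolationRemainder.lean`, keeping the location.) -/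
theorem rolle_finset_Icc {g : ℝ → ℝ} (hg : Continuous g) {u v : ℝ} (s : Finset ℝ) :
    s.Nonempty → (∀ x ∈ s, x ∈ Icc u v) → (∀ x ∈ s, g x = 0) →
      ∃ s' : Finset ℝ, s'.card + 1 = s.card ∧ (∀ x ∈ s', deriv g x = 0) ∧
        (∀ x ∈ s', x ∈ Icc u v) ∧ ∀ x ∈ s', ∃ a ∈ s, a < x := by
  classical
  induction s using Finset.induction_on_min with
  | empty => intro hne; exact absurd hne Finset.not_nonempty_empty
  | insert a t hlt ih =>
    intro _ hmem hzero
    have hat : a ∉ t := fun h => lt_irrefl a (hlt a h)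
    rcases t.eq_empty_or_nonempty with rfl | ht
    · exact ⟨∅, by simp, by simp, by simp, by simp⟩
    set b := t.min' ht with hb
    have hbt : b ∈ t := Finset.min'_mem t ht
    have hab : a < b := hlt b hbt
    obtain ⟨c, hc, hc'⟩ := exists_deriv_eq_zero hab hg.continuousOn
      (by rw [hzero a (Finset.mem_insert_self a t), hzero b (Finset.mem_insert_of_mem hbt)])
    obtain ⟨s', hcard, hder, hloc, hleft⟩ := ih ht (fun x hx => hmem x (Finset.mem_insert_of_mem hx))
      (fun x hx => hzero x (Finset.mem_insert_of_mem hx))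
    have hcs' : c ∉ s' := by
      intro hcs
      obtain ⟨a', ha', ha'c⟩ := hleft c hcs
      have : b ≤ a' := Finset.min'_le t a' ha'
      linarith [hc.2]
    refine ⟨insert c s', ?_, ?_, ?_, ?_⟩
    · rw [Finset.card_insert_of_notMem hcs', Finset.card_insert_of_notMem hat, hcard]
    · intro x hx
      rcases Finset.mem_insert.mp hx with rfl | hx
      · exact hc'
      · exact hder x hx
    · intro x hx
      rcases Finset.mem_insert.mp hx with rfl | hx
      · have ha := hmem a (Finset.mem_insert_self a t)
        have hb' := hmem b (Finset.mem_insert_of_mem hbt)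
        exact ⟨ha.1.trans hc.1.le, hc.2.le.trans hb'.2⟩
      · exact hloc x hx
    · intro x hx
      rcases Finset.mem_insert.mp hx with rfl | hx
      · exact ⟨a, Finset.mem_insert_self a t, hc.1⟩
      · obtain ⟨a', ha', h⟩ := hleft x hx
        exact ⟨a', Finset.mem_insert_of_mem ha', h⟩

/-- Iterated Rolle, hull form: if `F ∈ C^N`, `k + m ≤ N`, and `F^{(k)}` vanishes at `m + 1` points of
`[u, v]`, then `F^{(k+m)}` vanishes somewhere in `[u, v]`. [folklore] -/
theorem exists_iteratedDeriv_eq_zero_of_card {F : ℝ → ℝ} {N : ℕ} (hF : ContDiff ℝ N F) {u v : ℝ} :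
    ∀ (m k : ℕ) (S : Finset ℝ), k + m ≤ N → S.card = m + 1 →
      (∀ x ∈ S, x ∈ Icc u v) → (∀ x ∈ S, iteratedDeriv k F x = 0) →
        ∃ ξ ∈ Icc u v, iteratedDeriv (k + m) F ξ = 0 := by
  intro m
  induction m with
  | zero =>
    intro k S _ hcard hS hzero
    obtain ⟨x, hx⟩ := Finset.card_pos.mp (by omega : 0 < S.card)
    exact ⟨x, hS x hx, by simpa using hzero x hx⟩
  | succ m ih =>
    intro k S hkm hcard hS hzero
    have hcont : Continuous (iteratedDeriv k F) :=
      hF.continuous_iteratedDeriv k (by exact_mod_cast (by omega : k ≤ N))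
    obtain ⟨S', hS'card, hS'zero, hS'loc, -⟩ :=
      rolle_finset_Icc hcont S (Finset.card_pos.mp (by omega)) hS hzero
    obtain ⟨ξ, hξ, h⟩ := ih (k + 1) S' (by omega) (by omega) hS'loc
      (fun x hx => by rw [iteratedDeriv_succ]; exact hS'zero x hx)
    exact ⟨ξ, hξ, by rw [show k + (m + 1) = k + 1 + m by ring]; exact h⟩

/-- A `C^N` function whose `m`-th derivative (`m ≤ N`) does not vanish on `[u, v]` has at most `m`
zeros there: every finite set of its zeros in `[u, v]` has at most `m` elements. [folklore] -/
theorem card_le_of_iteratedDeriv_ne_zero {F : ℝ → ℝ} {N m : ℕ} (hF : ContDiff ℝ N F) (hm : m ≤ N)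
    {u v : ℝ} (hne : ∀ x ∈ Icc u v, iteratedDeriv m F x ≠ 0) (S : Finset ℝ)
    (hS : ∀ x ∈ S, x ∈ Icc u v) (hzero : ∀ x ∈ S, F x = 0) : S.card ≤ m := by
  by_contra h
  obtain ⟨S₁, hS₁S, hS₁card⟩ := Finset.exists_subset_card_eq (show m + 1 ≤ S.card by omega)
  obtain ⟨ξ, hξ, hξ0⟩ := exists_iteratedDeriv_eq_zero_of_card hF m 0 S₁ (by omega) hS₁card
    (fun x hx => hS x (hS₁S hx)) (fun x hx => by simpa using hzero x (hS₁S hx))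
  exact hne ξ hξ (by simpa using hξ0)

/-! ## The zero count is upper semicontinuous -/

variable {ι : Type*} {l : Filter ι}

/-- **Upper semicontinuity of the real zero count.** Let `g` be continuous with all its zeros in
`[a, b]` contained in the finite set `Z`, and suppose that at each `c ∈ Z` the derivative
`g^{(k c)}` is continuous at `c` and non-zero. If `G n → g` uniformly on `[a, b]`,
`(G n)^{(k c)} → g^{(k c)}` uniformly on `[a, b]` for each `c ∈ Z`, and eventually each `G n` is
`C^N` with `k c ≤ N`, then eventually the zeros of `G n` in `[a, b]` form a finite set with at most
`∑_{c ∈ Z} k c` elements. (For `k c` = the exact order of vanishing of `g` at `c` this is the count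
with multiplicity of the zeros of the limit.) [folklore] -/
theorem eventually_ncard_zeros_le {g : ℝ → ℝ} {G : ι → ℝ → ℝ} {a b : ℝ} {Z : Finset ℝ}
    {k : ℝ → ℕ} {N : ℕ} (hg : Continuous g)
    (hZ : ∀ x ∈ Icc a b, g x = 0 → x ∈ Z)
    (hkcont : ∀ c ∈ Z, ContinuousAt (iteratedDeriv (k c) g) c)
    (hkne : ∀ c ∈ Z, iteratedDeriv (k c) g c ≠ 0)
    (hkN : ∀ c ∈ Z, k c ≤ N)
    (hGN : ∀ᶠ n in l, ContDiff ℝ N (G n))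
    (hG : TendstoUniformlyOn G g l (Icc a b))
    (hGk : ∀ c ∈ Z, TendstoUniformlyOn (fun n => iteratedDeriv (k c) (G n))
      (iteratedDeriv (k c) g) l (Icc a b)) :
    ∀ᶠ n in l, {x | x ∈ Icc a b ∧ G n x = 0}.Finite ∧
      {x | x ∈ Icc a b ∧ G n x = 0}.ncard ≤ ∑ c ∈ Z, k c := by
  classical
  -- Step 1: radii around the points of `Z` on which `|g^{(k c)}| ≥ η c > 0`.
  have hrad : ∀ c ∈ Z, ∃ r η : ℝ, 0 < r ∧ 0 < η ∧
      ∀ x, dist x c ≤ r → η ≤ |iteratedDeriv (k c) g x| := by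
    intro c hc
    set w := iteratedDeriv (k c) g c with hw
    have hw0 : 0 < |w| := abs_pos.mpr (hkne c hc)
    obtain ⟨r, hr, hball⟩ := Metric.continuousAt_iff.mp (hkcont c hc) (|w| / 2) (by positivity)
    refine ⟨r / 2, |w| / 2, by positivity, by positivity, fun x hx => ?_⟩
    have hlt : dist (iteratedDeriv (k c) g x) w < |w| / 2 := hball (lt_of_le_of_lt hx (by linarith))
    rw [Real.dist_eq] at hlt
    have := abs_sub_abs_le_abs_sub w (iteratedDeriv (k c) g x)
    rw [abs_sub_comm] at this
    linarith
  choose! r η hr hη hbound using hrad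
  -- Step 2: away from these neighbourhoods `|g| ≥ η₀ > 0` on `[a, b]`.
  set K : Set ℝ := Icc a b ∩ {x | ∀ c ∈ Z, r c ≤ dist x c} with hK
  have hKc : IsCompact K := by
    refine isCompact_Icc.inter_right ?_
    have : {x : ℝ | ∀ c ∈ Z, r c ≤ dist x c} = ⋂ c ∈ Z, {x | r c ≤ dist x c} := by
      ext x; simp
    rw [this]
    exact isClosed_biInter fun c _ => isClosed_le continuous_const (continuous_id.dist continuous_const)
  have hKne : ∀ x ∈ K, g x ≠ 0 := by
    rintro x ⟨hxI, hxfar⟩ hx0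
    have hxZ := hZ x hxI hx0
    have := hxfar x hxZ
    rw [dist_self] at this
    exact absurd this (not_le.mpr (hr x hxZ))
  obtain ⟨η₀, hη₀, hη₀K⟩ : ∃ η₀ : ℝ, 0 < η₀ ∧ ∀ x ∈ K, η₀ ≤ |g x| := by
    rcases K.eq_empty_or_nonempty with hKe | hKn
    · exact ⟨1, one_pos, by simp [hKe]⟩
    · obtain ⟨x₀, hx₀, hmin⟩ := hKc.exists_isMinOn hKn (hg.abs).continuousOn
      exact ⟨|g x₀|, abs_pos.mpr (hKne x₀ hx₀), fun x hx => hmin hx⟩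
  -- Step 3: eventually `G n` is `η₀`-close to `g` and `(G n)^{(k c)}` is `η c`-close to `g^{(k c)}`.
  have h1 : ∀ᶠ n in l, ∀ x ∈ Icc a b, |G n x - g x| < η₀ := by
    have := (Metric.tendstoUniformlyOn_iff.mp hG) η₀ hη₀
    filter_upwards [this] with n hn x hx
    rw [← Real.dist_eq, dist_comm]; exact hn x hx
  have h2 : ∀ᶠ n in l, ∀ c ∈ Z, ∀ x ∈ Icc a b,
      |iteratedDeriv (k c) (G n) x - iteratedDeriv (k c) g x| < η c := by
    refine (Z.eventually_all).mpr fun c hc => ?_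
    have := (Metric.tendstoUniformlyOn_iff.mp (hGk c hc)) (η c) (hη c hc)
    filter_upwards [this] with n hn x hx
    rw [← Real.dist_eq, dist_comm]; exact hn x hx
  filter_upwards [h1, h2, hGN] with n hn1 hn2 hnN
  -- Step 4: every finite set of zeros of `G n` in `[a, b]` has at most `∑ k c` elements.
  have key : ∀ S : Finset ℝ, (∀ x ∈ S, x ∈ Icc a b ∧ G n x = 0) → S.card ≤ ∑ c ∈ Z, k c := by
    intro S hS
    -- each zero is `r c`-close to some `c ∈ Z`
    have hnear : ∀ x ∈ S, ∃ c ∈ Z, dist x c < r c := by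
      intro x hx
      by_contra hcon
      push Not at hcon
      have hxK : x ∈ K := ⟨(hS x hx).1, hcon⟩
      have h0 : G n x = 0 := (hS x hx).2
      have := hn1 x (hS x hx).1
      rw [h0, zero_sub, abs_neg] at this
      exact absurd (hη₀K x hxK) (not_le.mpr this)
    have hcover : S ⊆ Z.biUnion fun c => S.filter fun x => dist x c < r c := by
      intro x hx
      obtain ⟨c, hc, hxc⟩ := hnear x hx
      exact Finset.mem_biUnion.mpr ⟨c, hc, Finset.mem_filter.mpr ⟨hx, hxc⟩⟩
    refine (Finset.card_le_card hcover).trans (Finset.card_biUnion_le.trans (Finset.sum_le_sum ?_))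
    intro c hc
    -- in the `r c`-neighbourhood of `c`, `(G n)^{(k c)} ≠ 0` on `[a, b]`, so at most `k c` zeros
    refine card_le_of_iteratedDeriv_ne_zero hnN (hkN c hc)
      (u := max a (c - r c)) (v := min b (c + r c)) ?_ _ ?_ ?_
    · intro x hx hx0
      have hxI : x ∈ Icc a b := ⟨(le_max_left _ _).trans hx.1, hx.2.trans (min_le_left _ _)⟩
      have hxc : dist x c ≤ r c := by
        rw [Real.dist_eq, abs_le]
        constructor <;> linarith [(le_max_right _ _).trans hx.1, hx.2.trans (min_le_right _ _)]
      have hb := hbound c hc x hxc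
      have := hn2 c hc x hxI
      rw [hx0, zero_sub, abs_neg] at this
      exact absurd hb (not_le.mpr this)
    · intro x hx
      obtain ⟨hxS, hxc⟩ := Finset.mem_filter.mp hx
      have hxI := (hS x hxS).1
      rw [Real.dist_eq, abs_lt] at hxc
      exact ⟨max_le hxI.1 (by linarith), le_min hxI.2 (by linarith)⟩
    · intro x hx
      exact (hS x (Finset.mem_filter.mp hx).1).2
  -- Step 5: hence the zero set is finite, with the same bound on its cardinality.
  set A : Set ℝ := {x | x ∈ Icc a b ∧ G n x = 0} with hA
  have hfin : A.Finite := by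
    by_contra hinf
    obtain ⟨S, hSA, hScard⟩ := Set.Infinite.exists_subset_card_eq hinf (∑ c ∈ Z, k c + 1)
    have := key S fun x hx => hSA hx
    omega
  refine ⟨hfin, ?_⟩
  rw [Set.ncard_eq_toFinset_card A hfin]
  exact key _ fun x hx => by simpa [A] using hx

/-! ## Entire functions that are real on the real axis -/

/-- The real restriction `x ↦ Re f(x)` of an entire function is smooth. (Its iterated derivatives are
the real parts of the complex ones and the latter are real on `ℝ` when `f` is:
`Literature.Analysis.Complex.KiKim.iteratedDeriv_re_ofReal`, `im_iteratedDeriv_ofReal_eq_zero`.)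
[folklore] -/
theorem contDiff_re_ofReal {f : ℂ → ℂ} (hf : Differentiable ℂ f) {n : WithTop ℕ∞} :
    ContDiff ℝ n (fun x : ℝ => (f x).re) :=
  Complex.reCLM.contDiff.comp ((hf.contDiff.restrict_scalars ℝ).comp Complex.ofRealCLM.contDiff)

/-! ## From uniform convergence on a complex neighbourhood to `C^k`-convergence on a real segment -/

/-- **Weierstrass, real-segment form.** If entire functions `Φ n` converge locally uniformly to `Ψ`
on an open set `U ⊆ ℂ` containing the real segment `[a, b]`, then for every `j` the real parts of
the `j`-th complex derivatives converge uniformly on `[a, b]`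
(`TendstoLocallyUniformlyOn.deriv` iterated, then restricted). [folklore] -/
theorem tendstoUniformlyOn_re_iteratedDeriv {Φ : ι → ℂ → ℂ} {Ψ : ℂ → ℂ} {U : Set ℂ}
    (hU : IsOpen U) (hΦ : ∀ n, Differentiable ℂ (Φ n))
    (hconv : TendstoLocallyUniformlyOn Φ Ψ l U) {a b : ℝ}
    (hab : ∀ x ∈ Icc a b, (x : ℂ) ∈ U) (j : ℕ) :
    TendstoUniformlyOn (fun n (x : ℝ) => (iteratedDeriv j (Φ n) x).re)
      (fun x : ℝ => (iteratedDeriv j Ψ x).re) l (Icc a b) := by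
  -- iterated derivatives converge locally uniformly on `U`
  have hj : ∀ j : ℕ, TendstoLocallyUniformlyOn (fun n => iteratedDeriv j (Φ n))
      (iteratedDeriv j Ψ) l U := by
    intro j
    induction j with
    | zero => simpa using hconv
    | succ j ih =>
      have hdiff : ∀ᶠ n in l, DifferentiableOn ℂ (iteratedDeriv j (Φ n)) U :=
        Eventually.of_forall fun n =>
          (((hΦ n).contDiff (n := (j + 1 : ℕ))).differentiable_iteratedDeriv' j).differentiableOn
      have := ih.deriv hdiff hU
      simp only [iteratedDeriv_succ]
      exact this
  -- uniformly on the compact segment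
  set C : Set ℂ := ((↑) : ℝ → ℂ) '' Icc a b with hC
  have hCc : IsCompact C := isCompact_Icc.image Complex.continuous_ofReal
  have hCU : C ⊆ U := by
    rintro _ ⟨x, hx, rfl⟩; exact hab x hx
  have hunif : TendstoUniformlyOn (fun n => iteratedDeriv j (Φ n)) (iteratedDeriv j Ψ) l C :=
    (tendstoLocallyUniformlyOn_iff_forall_isCompact hU).mp (hj j) C hCU hCc
  have h2 := Complex.reCLM.uniformContinuous.comp_tendstoUniformlyOn
    (hunif.comp ((↑) : ℝ → ℂ))
  refine h2.mono ?_
  intro x hx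
  exact ⟨x, hx, rfl⟩

end RealZeroCount

end Summit.RiemannHypothesis.RiemannHypothesis.Theorems

end
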